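import Summits.RiemannHypothesis.RiemannHypothesis.Theses.SpectralTrace
import Summits.RiemannHypothesis.RiemannHypothesis.Theorems.SpectralTraceHeckeSurrogateDefs
import Summits.RiemannHypothesis.RiemannHypothesis.Theorems.SpectralTraceWindowTracePrime2StubXi2Surrogate
import Summits.RiemannHypothesis.RiemannHypothesis.Theorems.SpectralTraceWindowTracePrime2StubLogDerivDiff
import Summits.RiemannHypothesis.RiemannHypothesis.Theorems.SpectralTraceWindowTracePrime2StubZeroCount
import Summits.RiemannHypothesis.RiemannHypothesis.Theorems.SpectralTraceWindowTracePrime2StubContourIdentity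
import Summits.RiemannHypothesis.RiemannHypothesis.Theorems.SpectralTraceWindowTracePrime2StubGoodHeights
import Summits.RiemannHypothesis.RiemannHypothesis.Theorems.SpectralTraceWindowTracePrime2StubZeroSumLimit
import Summits.RiemannHypothesis.RiemannHypothesis.Theorems.SpectralTraceWindowTracePrime2StubWindowAssembly
import Literature.Uncategorized.GammaLowerBound
import Literature.Uncategorized.GammaLowerBoundProofs
import Literature.Uncategorized.HorizontalLogDerivBoundProofs
import HarnessLib

/-!
# The relative explicit formula for surrogates and the reduction of `WindowTracePrime2` to selection —
# stub `stub_reduction`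

Route `RiemannHypothesis/SpectralTrace`, crux `WindowTracePrime2` (stmt-RiemannHypothesis-11196), line
`hecke-cusp-perturbation-surrogate`, registered stub **R** `stub_reduction` of the lead reshape r3 (skeleton
`Cruxes/WindowTracePrime2/Lines/hecke_cusp_perturbation_surrogate.lean`; vocabulary
`Theorems/SpectralTraceHeckeSurrogateDefs.lean`).

This file COMPOSES, by name, the landed stubs of the line:
`stub_logDerivDiff` (right half-plane control), `stub_zeroCount` (zeros in a strip, polynomial local counts),
`stub_contourIdentity` (weighted residue theorem on `[1-σ,σ]×[-T,T]`, left edge folded),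
`stub_goodHeights` (good heights for a pair of surrogates), `stub_zeroSumLimit` (absolute summability over
`ZIdx E`, rectangle sums → `∑'`), `stub_windowAssembly` (the relative explicit formula), together with the
discharged analytic interfaces `GammaLowerBound_holds`, `HorizontalLogDerivBound_holds` and the landed
`stub_xi2Surrogate : IsSurrogate xi2`, into two unconditional theorems:

* `hasSum_weilMellin_zeros_of_isSurrogate` — **the relative explicit formula**: for EVERY window-invisible
  self-dual degree-one surrogate `E` (`IsSurrogate E`: entire, order `≤ 1`, `E(1-s) = E(s)`,
  `E(s) = s(s-1)Γ_ℝ(s)(1 + 2^{-s} + Σ_{ν_k ≥ 3} c_k ν_k^{-s})` far right) and every Weil test `g` supported in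
  `[-log 3, log 3]`, the zeros of `E` counted with multiplicity reproduce the Weil functional:
  `HasSum (fun i : ZIdx E ↦ ĝ(ρ_i)) (W g)`;
* `stub_reduction` / `windowTracePrime2_of_selection` — hence, if SOME surrogate has all its zeros on
  `Re s = 1/2`, the ordinates of its zeros realise `Trace(log 3)`, i.e. the crux
  `SpectralTrace.WindowTracePrime2` holds. The crux is thereby reduced, kernel-checked, to the selection problem `∃ E, IsSurrogate E ∧ ∀ s, E s = 0 → s.re = 1/2` (RH-implied via
  `E = ξ₂`; no unconditional instance is known).

References: E. Bombieri, *Remarks on Weil's quadratic functional in the theory of prime numbers I*, Rend.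
Mat. Acc. Lincei (9) 11 (2000), §2 Thm 2 [Bombieri2000Weil]; E. Hecke, *Über die Bestimmung Dirichletscher
Reihen durch ihre Funktionalgleichung*, Math. Ann. 112 (1936), §2 [Hecke1936].
-/

noncomputable section

set_option linter.dupNamespace false

namespace Summit.RiemannHypothesis.RiemannHypothesis.Theorems.HeckeSurrogate

open Complex Filter Set MeasureTheory
open scoped Real Topology
open Literature.NumberTheory.LFunctions
open Literature.Uncategorized

/-- **The relative explicit formula for surrogates** (unconditional): for every window-invisible self-dual
degree-one surrogate `E` and every Weil test `g` with `tsupport g ⊆ [-log 3, log 3]`, the zeros of `E`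
with multiplicity give `Σ_i ĝ(ρ_i) = W(g)` as an absolutely convergent `HasSum` over `ZIdx E`. Composition
of the six landed stubs of the line with the discharged interfaces `GammaLowerBound_holds`,
`HorizontalLogDerivBound_holds`, `stub_xi2Surrogate`. [cite: Bombieri2000Weil, §2 Thm 2] -/
theorem hasSum_weilMellin_zeros_of_isSurrogate {E : ℂ → ℂ} (hS : IsSurrogate E) {g : ℝ → ℂ}
    (hg : IsWeilTest g) (hsupp : tsupport g ⊆ Set.Icc (-Real.log 3) (Real.log 3)) :
    HasSum (fun i : ZIdx E => weilMellin g (zval i)) (weilFunctional g) :=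
  stub_windowAssembly stub_contourIdentity stub_goodHeights stub_zeroSumLimit GammaLowerBound_holds
    HorizontalLogDerivBound_holds stub_xi2Surrogate stub_logDerivDiff
    (stub_zeroCount GammaLowerBound_holds stub_logDerivDiff) E hS g hg hsupp

/-- The same with the zeros written as `1/2 + i·Im ρ` when all zeros of `E` are critical. [folklore] -/
theorem hasSum_weilMellin_ordinates_of_isSurrogate {E : ℂ → ℂ} (hS : IsSurrogate E)
    (hcrit : ∀ s : ℂ, E s = 0 → s.re = 1 / 2) {g : ℝ → ℂ} (hg : IsWeilTest g)
    (hsupp : tsupport g ⊆ Set.Icc (-Real.log 3) (Real.log 3)) :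
    HasSum (fun i : ZIdx E => weilMellin g (1 / 2 + (((zval i).im : ℝ) : ℂ) * Complex.I))
      (weilFunctional g) := by
  have h := hasSum_weilMellin_zeros_of_isSurrogate hS hg hsupp
  have heq : ∀ i : ZIdx E, (1 / 2 : ℂ) + (((zval i).im : ℝ) : ℂ) * Complex.I = zval i := by
    intro i
    have hre : (zval i).re = 1 / 2 := hcrit _ i.1.2
    apply Complex.ext <;> simp [hre]
  simpa only [heq] using h

/-- **`stub_reduction`** (registered stub R of the line `hecke-cusp-perturbation-surrogate`, crux
stmt-RiemannHypothesis-11196): the crux `WindowTracePrime2` REDUCES to the selection problem — if some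
window-invisible self-dual degree-one surrogate has all its zeros on the critical line, the ordinates of its
zeros with multiplicity (`ι = ZIdx E`, `γ_i = Im ρ_i`) form a real unit-multiplicity family reproducing the
Weil functional on every Weil test supported in `[-log 3, log 3]`. [cite: Bombieri2000Weil, §2 Thm 2] -/
theorem stub_reduction :
    ∀ E : ℂ → ℂ, IsSurrogate E → (∀ s : ℂ, E s = 0 → s.re = 1 / 2) →
      ∀ g : ℝ → ℂ, IsWeilTest g → tsupport g ⊆ Set.Icc (-Real.log 3) (Real.log 3) →
        HasSum (fun i : ZIdx E => weilMellin g (1 / 2 + (((zval i).im : ℝ) : ℂ) * Complex.I))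
          (weilFunctional g) :=
  fun _ hS hcrit _ hg hsupp => hasSum_weilMellin_ordinates_of_isSurrogate hS hcrit hg hsupp

/-- **Reduction of the crux to selection**: if some window-invisible self-dual degree-one surrogate has all
its zeros on the critical line, then `SpectralTrace.WindowTracePrime2` holds (witness `ι = ZIdx E`,
`γ_i = Im ρ_i`). [folklore] -/
theorem windowTracePrime2_of_selection
    (h : ∃ E : ℂ → ℂ, IsSurrogate E ∧ ∀ s : ℂ, E s = 0 → s.re = 1 / 2) :
    Summit.RiemannHypothesis.RiemannHypothesis.Theses.SpectralTrace.WindowTracePrime2 := by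
  obtain ⟨E, hS, hcrit⟩ := h
  exact ⟨ZIdx E, fun i => (zval i).im, stub_reduction E hS hcrit⟩

/-- In particular (sanity, and the honest status of the bet): under the Riemann hypothesis the degenerate
surrogate `ξ₂ = 2ξ` is a selection, so RH ⇒ the crux through this line as well. [folklore] -/
theorem windowTracePrime2_of_riemannHypothesis_via_surrogate (hRH : _root_.RiemannHypothesis) :
    Summit.RiemannHypothesis.RiemannHypothesis.Theses.SpectralTrace.WindowTracePrime2 := by
  refine windowTracePrime2_of_selection ⟨xi2, stub_xi2Surrogate, fun s hs => ?_⟩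
  have hxi : riemannXi s = 0 := by
    have h2 : (2 : ℂ) * riemannXi s = 0 := hs
    simpa using h2
  obtain ⟨hζ, h0, h1, -⟩ := riemannXi_zero_prop hxi
  refine hRH s hζ ?_ (by rintro rfl; norm_num at h1)
  rintro ⟨n, hn⟩
  have h0' : (0 : ℝ) < s.re := h0
  rw [hn] at h0'
  simp at h0'
  linarith

end Summit.RiemannHypothesis.RiemannHypothesis.Theorems.HeckeSurrogate

end
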